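import Mathlib
import Literature.Barriers.RiemannHypothesis.MollifierLimitations
import HarnessLib

/-!
# Bettin–Chandee–Radziwiłł 2017, Theorem 1: the mean square of `ζ · A` for an ARBITRARY Dirichlet polynomial `A` of length `T^θ`, `θ < 17/33`

LABEL (cell `landau-siegel`, §C literature harvest, topic r5 = mollifier-optimisation numerics &
Levinson–Conrey records; HARVEST row r5-R19; bears_on F-S3 §C / §B-len / §B-multi E(d) registries):
the in-print ceiling for the LENGTH of an UNSPECIALISED mollifier piece in the `ζ` proxy. «The
programme SEARCHES and TYPES; no claim about Landau–Siegel zeros, Theorems 1–2 of arXiv:2211.02515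
or a repaired Margin232 until a kernel theorem says so.»

Topic `Literature/NumberTheory/LFunctions` (namespace `Literature.NumberTheory.LFunctions`, glue in
the sub-namespace `BCR2017`). STATEMENT LAYER (D-0014): ONE named fact (Theorem 1), two glue
definitions with bodies, no lemmas (the smooth-weighted mean square (1.1) and the main term of
Theorem 1), over the tree's `Literature.Barriers.RiemannHypothesis.dirichletMollifier`
(`A(s) = ∑_{n ≤ N} a(n) n^{-s}`, `MollifierLimitations.lean`). The `θ < 1/2` predecessor
(Balasubramanian–Conrey–Heath-Brown 1985, as quoted in (1.2) of this paper, sharp cut-off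
`[T, 2T]`) is ALREADY the named fact
`Literature.Barriers.RiemannHypothesis.BalasubramanianConreyHeathBrown1985_meanSquare`
(`MollifierLimitationsPropB.lean`) and is not restated.

## What the source prints (held text `paper:galaxy-pdf-9155678564176035320` = arXiv:1411.7764,
## chunks p0001–p0005, read 2026-08-26)

S. Bettin, V. Chandee, M. Radziwiłł, *The mean square of the product of the Riemann zeta function
with Dirichlet polynomials*, J. reine angew. Math. **729** (2017) 51–79
[BettinChandeeRadziwill2017].

(1.1): `I = ∫_ℝ |ζ(½+it)|² |A(½+it)|² φ(t/T) dt` "with `φ(x)` a smooth function supported in `[1,2]`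
and `A(s) := ∑_{n ≤ T^θ} a_n n^{-s}`, `a_n ≪ n^ε`, `θ < 1`."

> **Theorem 1.** Let `I` and `A(s)` be as above. If `θ < 1/2 + δ`, with `δ = 1/66` then,
> `I = ∑_{d,e ≤ T^θ} (a_d ā_e/[d,e]) · ∫_ℝ (log(t (d,e)²/(2π de)) + 2γ) φ(t/T) dt
>      + O(T^{3/20+ε} N^{33/20} + T^{1/3+ε})`, with `N := T^θ`.

Context printed on the same pages (NOT typed here, recorded for the harvest): (p0002) "In complete
generality the formula (1.2) fails when `θ > 1`. Balasubramanian, Conrey and Heath-Brown conjecture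
that it remains true provided that `θ < 1`. This is known as the `θ = 1` conjecture"; **Theorem 2**
(p0003): under the trilinear Kloosterman-fraction bound (1.3) with exponents `(r,t)` the asymptotic
holds for `θ < 1/2 + (0.5 − r)/(1 + 2(r + 2t))` (Duke–Friedlander–Iwaniec: `r = 23/48, t = 1/2`;
Bettin–Chandee: `r = 9/20, t = 7/20`, giving `17/33`); **Conjecture 1** ((1.4), square-root
cancellation in the two shortest variables) ⇒ the asymptotic for every `θ < 1` ⇒ **Corollary 1**:
the Lindelöf Hypothesis; (p0003) for the `q`-aspect analogue `∑_χ |L(½,χ)|²|D(½,χ)|²` "our proof of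
Theorem 1 would not extend to give an asymptotic formula in this case, and additional input is
needed"; **Theorem 3** (products `A = B·C` of two arbitrary polynomials: `θ < 3/5`), **Theorem 4**
(`A` smooth of length `√T` times `B` arbitrary of length `T^{1/4−ε}`: `θ < 3/4`), **Corollary 2**
(`∫_T^{2T} |ζ(½+it)|³ dt ≪ T (log T)^{9/4}` unconditionally).

## Lean rendering (audit notes)

* `φ` "smooth, supported in `[1,2]`": `∀ n : ℕ, ContDiff ℝ n φ` and `Function.support φ ⊆ [1,2]`
  (real-valued weight, as used in the moment).
* `A(s) = ∑_{n ≤ T^θ}`: `dirichletMollifier a ⌊T^θ⌋₊`, and the main-term double sum runs over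
  `1 ≤ d, e ≤ ⌊T^θ⌋₊` (the natural reading of `d, e ≤ T^θ`); `N := T^θ` in the error term is kept
  real (`(T^θ)^{33/20}`).
* `a_n ≪ n^ε` (for every `ε > 0`): the admissible class is, as in the tree's BCHB fact, "for every
  `δ > 0` and `n ≥ 1`, `|a(n)| ≤ C(δ) n^δ`" for a given family of implied constants `C : ℝ → ℝ`; the
  `O(·)` is rendered with an implied constant `K` and a threshold `T₀` allowed to depend on `θ`,
  `φ`, `C` and the `ε` of the error exponent (a dependence the printed `O` permits; never stronger
  than the source).
* The main term is real: the kernel `(log(t(d,e)²/(2πde)) + 2γ)/[d,e]` is real and symmetric in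
  `(d,e)`, so `∑ a_d ā_e · kernel = ∑ Re(a_d ā_e) · kernel`; `BCR2017.mainTerm` is defined directly
  as that real number (same device as `bchQuadForm`). The `t`-integral is over `ℝ` (Lebesgue); for
  `T > 0` the weight `φ(t/T)` vanishes off `[T, 2T]`, on which the logarithm is the genuine one.

## References

* [BettinChandeeRadziwill2017] as above: §1 (1.1), (1.2), Theorem 1 (arXiv p. 2), Theorem 2,
  Conjecture 1, Corollary 1 (p. 3), Theorems 3–4, Corollary 2 (pp. 3–4).
* Tree: `Literature/Barriers/RiemannHypothesis/MollifierLimitations.lean` (`dirichletMollifier`),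
  `MollifierLimitationsPropB.lean` (`bchQuadForm`,
  `BalasubramanianConreyHeathBrown1985_meanSquare`),
  `MollifierLimitationsProofs.lean` (docstring census of admissible lengths `17/33`, `6/11`, `4/7`).
-/

noncomputable section

open Complex MeasureTheory Real Finset
open scoped ComplexConjugate

namespace Literature.NumberTheory.LFunctions

namespace BCR2017

open Literature.Barriers.RiemannHypothesis (dirichletMollifier)

/-- The smooth-weighted twisted mean square (1.1) of [BCR17]:
`I = ∫_ℝ |ζ(½+it) A(½+it)|² φ(t/T) dt` with `A = dirichletMollifier a N`.
[cite: BettinChandeeRadziwill2017, §1 eq. (1.1)] -/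
def weightedMeanSquare (φ : ℝ → ℝ) (a : ℕ → ℂ) (N : ℕ) (T : ℝ) : ℝ :=
  ∫ t : ℝ, ‖riemannZeta (1 / 2 + t * I) * dirichletMollifier a N (1 / 2 + t * I)‖ ^ 2 * φ (t / T)

/-- The main term of [BCR17] Theorem 1:
`∑_{1 ≤ d,e ≤ N} Re(a_d ā_e)/[d,e] · ∫_ℝ (log(t (d,e)²/(2π d e)) + 2γ) φ(t/T) dt` (a real number;
the module docstring explains why `Re` is harmless).
[cite: BettinChandeeRadziwill2017, Theorem 1] -/
def mainTerm (φ : ℝ → ℝ) (a : ℕ → ℂ) (N : ℕ) (T : ℝ) : ℝ :=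
  ∑ d ∈ Icc 1 N, ∑ e ∈ Icc 1 N,
    (a d * conj (a e)).re / (Nat.lcm d e : ℝ) *
      ∫ t : ℝ, (Real.log (t * (Nat.gcd d e : ℝ) ^ 2 / (2 * π * d * e)) +
        2 * Real.eulerMascheroniConstant) * φ (t / T)

end BCR2017

/-- **Bettin–Chandee–Radziwiłł 2017, Theorem 1** (NAMED FACT, not proved here): for
`0 < θ < 17/33 = 1/2 + 1/66`, every smooth weight `φ` supported in `[1,2]`, every family `C` of
implied constants for `a_n ≪ n^ε` and every `ε > 0` there are `K` and `T₀` such that for all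
`T ≥ T₀` and all coefficient sequences `a` with `|a(n)| ≤ C(δ) n^δ` (`δ > 0`, `n ≥ 1`):
`dist(I, MainTerm) = |I − MainTerm| ≤ K · (T^{3/20+ε} (T^θ)^{33/20} + T^{1/3+ε})` (`Real.dist_eq`),
`I = BCR2017.weightedMeanSquare`,
`MainTerm = BCR2017.mainTerm`, `N = ⌊T^θ⌋₊`. Printed: "If `θ < 1/2 + δ`, with `δ = 1/66` then
`I = ∑_{d,e ≤ T^θ} (a_d ā_e/[d,e]) ∫ (log(t(d,e)²/(2πde)) + 2γ) φ(t/T) dt + O(T^{3/20+ε}N^{33/20} +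
T^{1/3+ε})` (with `N := T^θ`)." The error is `o(T)` exactly for `θ < 17/33`. Status:
theorem-in-print (input: Bettin–Chandee trilinear forms with Kloosterman fractions).
[cite: BettinChandeeRadziwill2017, Theorem 1] -/
def bettinChandeeRadziwill2017_theorem1 : Prop :=
  ∀ θ : ℝ, 0 < θ → θ < 17 / 33 →
    ∀ φ : ℝ → ℝ, (∀ n : ℕ, ContDiff ℝ n φ) → Function.support φ ⊆ Set.Icc 1 2 →
      ∀ C : ℝ → ℝ, ∀ ε : ℝ, 0 < ε →
        ∃ K T₀ : ℝ, ∀ T : ℝ, T₀ ≤ T →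
          ∀ a : ℕ → ℂ,
            (∀ δ : ℝ, 0 < δ → ∀ n : ℕ, 1 ≤ n → ‖a n‖ ≤ C δ * (n : ℝ) ^ δ) →
              dist (BCR2017.weightedMeanSquare φ a ⌊T ^ θ⌋₊ T) (BCR2017.mainTerm φ a ⌊T ^ θ⌋₊ T) ≤
                K * (T ^ (3 / 20 + ε) * (T ^ θ) ^ (33 / 20 : ℝ) + T ^ (1 / 3 + ε))

end Literature.NumberTheory.LFunctions
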